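import Summits.RiemannHypothesis.RiemannHypothesis.Theorems.WeilTwoPrimeDeflE72Def
import Summits.RiemannHypothesis.RiemannHypothesis.Theorems.WeilTwoPrimeDeflE72DataPE23
import Literature.NumberTheory.LFunctions.WeilBlockRowsR
import HarnessLib

/-!
# Deflated two-prime certificate E72: the materialized even block agrees with `P_r + Σ μ ĉ ĉᵀ`, rows 70–79

`WeilCert.checkPmRowG` for certificate E72 (even block), by `decide +kernel`. Pure proof file; nothing is asserted.
-/

noncomputable section

namespace Summit.RiemannHypothesis.RiemannHypothesis.Theorems.EvenWinsBeyondArch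

open Literature.NumberTheory.LFunctions

set_option maxHeartbeats 0 in
/-- Row 70 of the materialized even block is row 70 of `P_r + Σ μ ĉ ĉᵀ` (certificate E72). [folklore] -/
theorem checkPmRowG0_70_weilCertDeflE72 : weilCertDeflE72Base.checkPmRowG weilCertDeflE72P weilCertDeflE72PmE 0 70 = true := by
  decide +kernel

set_option maxHeartbeats 0 in
/-- Row 71 of the materialized even block is row 71 of `P_r + Σ μ ĉ ĉᵀ` (certificate E72). [folklore] -/
theorem checkPmRowG0_71_weilCertDeflE72 : weilCertDeflE72Base.checkPmRowG weilCertDeflE72P weilCertDeflE72PmE 0 71 = true := by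
  decide +kernel

set_option maxHeartbeats 0 in
/-- Row 72 of the materialized even block is row 72 of `P_r + Σ μ ĉ ĉᵀ` (certificate E72). [folklore] -/
theorem checkPmRowG0_72_weilCertDeflE72 : weilCertDeflE72Base.checkPmRowG weilCertDeflE72P weilCertDeflE72PmE 0 72 = true := by
  decide +kernel

set_option maxHeartbeats 0 in
/-- Row 73 of the materialized even block is row 73 of `P_r + Σ μ ĉ ĉᵀ` (certificate E72). [folklore] -/
theorem checkPmRowG0_73_weilCertDeflE72 : weilCertDeflE72Base.checkPmRowG weilCertDeflE72P weilCertDeflE72PmE 0 73 = true := by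
  decide +kernel

set_option maxHeartbeats 0 in
/-- Row 74 of the materialized even block is row 74 of `P_r + Σ μ ĉ ĉᵀ` (certificate E72). [folklore] -/
theorem checkPmRowG0_74_weilCertDeflE72 : weilCertDeflE72Base.checkPmRowG weilCertDeflE72P weilCertDeflE72PmE 0 74 = true := by
  decide +kernel

set_option maxHeartbeats 0 in
/-- Row 75 of the materialized even block is row 75 of `P_r + Σ μ ĉ ĉᵀ` (certificate E72). [folklore] -/
theorem checkPmRowG0_75_weilCertDeflE72 : weilCertDeflE72Base.checkPmRowG weilCertDeflE72P weilCertDeflE72PmE 0 75 = true := by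
  decide +kernel

set_option maxHeartbeats 0 in
/-- Row 76 of the materialized even block is row 76 of `P_r + Σ μ ĉ ĉᵀ` (certificate E72). [folklore] -/
theorem checkPmRowG0_76_weilCertDeflE72 : weilCertDeflE72Base.checkPmRowG weilCertDeflE72P weilCertDeflE72PmE 0 76 = true := by
  decide +kernel

set_option maxHeartbeats 0 in
/-- Row 77 of the materialized even block is row 77 of `P_r + Σ μ ĉ ĉᵀ` (certificate E72). [folklore] -/
theorem checkPmRowG0_77_weilCertDeflE72 : weilCertDeflE72Base.checkPmRowG weilCertDeflE72P weilCertDeflE72PmE 0 77 = true := by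
  decide +kernel

set_option maxHeartbeats 0 in
/-- Row 78 of the materialized even block is row 78 of `P_r + Σ μ ĉ ĉᵀ` (certificate E72). [folklore] -/
theorem checkPmRowG0_78_weilCertDeflE72 : weilCertDeflE72Base.checkPmRowG weilCertDeflE72P weilCertDeflE72PmE 0 78 = true := by
  decide +kernel

set_option maxHeartbeats 0 in
/-- Row 79 of the materialized even block is row 79 of `P_r + Σ μ ĉ ĉᵀ` (certificate E72). [folklore] -/
theorem checkPmRowG0_79_weilCertDeflE72 : weilCertDeflE72Base.checkPmRowG weilCertDeflE72P weilCertDeflE72PmE 0 79 = true := by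
  decide +kernel


end Summit.RiemannHypothesis.RiemannHypothesis.Theorems.EvenWinsBeyondArch
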